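/-
Copyright (c) 2026 the pub-hodgecm-mathlib formalisation cell (harness21).  Prover seat hodgecm-mathlib-LH4-p05 (g4), req620 Track A «(D-RAM) FOUR-FRAME» squad
(unit U3_Laws, (KSS) road under the (R-22) «κS-RECUT»: THE SIGN-TOKEN-GENERIC (KSS) REDUCTION ENGINE «MODULO κ-STAGE B» — the eightfold signed κ-model sum from κ-Stage A
and two κ-Stage-B sums carrying an ARBITRARY sign token `S`; dealer LH4-plan (g12) WORD #1 (4)(iv), SHAPE MEMO v1 `F0/P3c/LH4/LH4-plan/g11/KS-RECUT-SHAPE-MEMO.v1` §2∕§3 (iv)).  2026-09-04.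
-/
import Summits.HodgeConjecture.HodgeConjecture.Theorems.F0P3cDyRamDiagonalKappaOrbitCount      -- ★ p856579 (Oκ2c)₀ (LH4-p05 (g3)): `cast_sum_signChar_mul_ncard_eq_eight_mul_finsum_kappaCount_zero`; brings the DEFS leaf (`kappaCount`), ★ StrataDefs ED. 3, ★ TorusDefs
import Summits.HodgeConjecture.HodgeConjecture.Theorems.F0P3cDyRamStableModelSumOfStageB        -- ★ p856175 (LH4-p11): §1 `not_exists_mul_map_eq_of_dichotomy`, §2 `v_vecCons_eq_one_of_isElementDatum`, `vecCons_injective_of_isElementDatum`; brings ★ LawDefs (`DyadicFence`)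
import Summits.HodgeConjecture.HodgeConjecture.Theorems.F0P3cDyRamFourFrameLawDefsR             -- ★ DEFS LEAF №1-R p855074: `shiftR`
import HarnessLib

/-!
# Crux `H413`, line LH4 «(D-RAM) FOUR-FRAME» road — unit U3_Laws (iii), (KSS) road under (R-22) «κS-RECUT»: THE SIGN-TOKEN-GENERIC REDUCTION ENGINE —
# the eightfold signed κ-model sum, both vertex types, from κ-Stage A and two κ-Stage-B sums whose right-hand sides carry an ARBITRARY sign token `S`

Cell `hodgecm-mathlib` (D-0151), FLOOR 0, crux item H413 = `stmt-HodgeConjecture-24833`, route of record `HCCMUnconditional`; squad F0∕P3c∕LH4 (req618∕req620).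
THEOREMS ONLY (no `def`, no instance, no notation, no `sorry`, default heartbeats); lane `--supports stmt-HodgeConjecture-24833` (count-neutral).

WHY THIS FILE.  ★ `F0P3cDyRamKappaSignModelSumOfKappaStageB.kappaSignModelSum_of_kappaStageB_complete` (p856605 ∕ ED. 2 p856683, LH4-p05 (g3)) reduces the registered (KSS)
sentence `stub_U3_kappaSignModelSum` to κ-Stage A₂ and the two SIGNED κ-Stage-B sums (κS-B₀)∕(κS-B₂) whose sign token is `w_i·S_i`, `w = (ω(−1), ω(−1), 1)`,
`S_i = baseSign σ i · ω(fPartProd δ (a,b,1) i)`.  Under (R-22) (REF5 (g22) R5-109, LH4-r01 (g4) GD∕GD2, LHref-N #343, LH4-p05 (g3) «=») those two children are, AS ∀-K SENTENCES,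
paper-refuted at `(d,t) = (6,8)`, `e_F = 4`: the honest token carries an extra factor `Ω(c_i)` (★ p856880 `…KappaSignDictionaryRecut` (R0)(R1)(R2)), whose exact typing (a ★ `def`
with a junk convention, or representative binders, or a schedule parameter) is the heir LEAD's ORDER OF SHAPE.  The reduction itself never looks at the token: it is linear algebra
over `ℚ` (`8·(S·A∕4) = 2·S·A`) after κ-Stage A.  So this file proves it ONCE for an ARBITRARY token
`S : (σ, ϖ, d, t, δ, a, b, i) ↦ ℤ` (a function binder, polymorphic in the complete valued field `K` with finite residue field), with the ED. 10 binder telescope of the children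
and of the (KSS) conclusion VERBATIM around it; every re-lettered (KSS²) head of record — whatever the ORDER decides the Ω token is — is then ONE APPLICATION
`kappaSignModelSum_of_kappaStageB_token (S := fun σ ϖ d t δ a b i => ‹token›) hAκ2 hBκS hBκS₂` (the instantiated binder types are the children's sentences up to β-reduction,
so the by-name tie `type_of% @stub = type_of% @(head …)` is `rfl`).  The ED. 10 token is the instance `S := fun σ _ _ _ δ a b i => w_i * (baseSign σ i * normSign σ (fPartProd δ ![a,b,1] i))`:
HOME probe `F0/P3c/LH4/LH4-p05/g4/TokenEngine.TIE-ED2.v1.LH4p05g4.lean` re-derives ★ ED. 2's head of record `kappaSignModelSum_of_kappaStageB_complete` as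
`example : type_of% @‹★ ED. 2 head› := fun hA h0 h2 => kappaSignModelSum_of_kappaStageB_token (S := ‹ED. 10 token›) hA h0 h2` (elaborates, rc 0).

THE MATHEMATICS (★ ED. 2's proof, token-blind).  Behind the dyadic fence, at a ramified quadratic datum `(σ, ϖ, d, t)` over a complete `K` with finite residue field, for a
`σ`-fixed unit `c` with the index-two dichotomy: (1) `c` is a NON-NORM and (2) `(a², b², 1)` is a regular unit diagonal (★ p856175 §1–§2); (3) TYPE 0: ★ (Oκ2c)₀
`cast_sum_signChar_mul_ncard_eq_eight_mul_finsum_kappaCount_zero` (UNCONDITIONAL κ-Stage A at `tv = 0`) turns `Σ_e χ⁰_i(e)·C₀(e)` into `8·X₀`, and `hBκS` says `X₀ = S·ampl q k B ∕ 4`;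
(4) TYPE 2: `hAκ2` (κ-Stage A₂ with multiplicity, ★ p856633 by name) turns `Σ_e χ⁰_i(e)·C₂(e)` into `8·X₂`, and `hBκS₂` says `X₂ = S·ampl q k (B + τ d) ∕ 4`; (5) `8·(S·A∕4) = 2·S·A`.

WHAT IS PROVED.
* §1 `kappaSignModelSum_of_kappaStageB_token (S) (hAκ2) (hBκS) (hBκS₂)` — the (KSS)-shaped eightfold conclusion with sign token `S σ ϖ d t δ a b i`, from κ-Stage A₂ (the
  registered (κ-A₂) `stub_U3_kappaStageA_typeTwo_mult` VERBATIM) and the two κ-Stage-B sums with token `S` (the ED. 10 (κS-B₀)∕(κS-B₂) telescopes VERBATIM, `[CompleteSpace K]`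
  on every K-binder, only the RHS sign replaced by `S σ ϖ d t δ a b i`).
HONEST LABEL.  Count-neutral (`--supports`); CONDITIONAL on PROVER TARGETS (κ-Stage A₂ is ★ p856633; the κ-Stage-B sums are census laws in model currency — targets, never
literature facts, and their signed typing is under (R-22) re-lettering); nothing printed is asserted and no `def … : Prop` is introduced; `HC_CM` is proved only modulo the 7
printed citations (2 remaining named inputs: hLiu418 = `stmt-HodgeConjecture-24832`, h413 = `stmt-HodgeConjecture-24833`) until rung 0 closes.

## References
* [Kottwitz1986BaseChangeUnits] R. E. Kottwitz, *Base change for unit elements of Hecke algebras*, Compositio Math. 60 (1986), §1 pp. 240–241 (κ-orbital integrals of units as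
  signed lattice counts modulo the torus).
* [Rogawski1990] J. D. Rogawski, *Automorphic Representations of Unitary Groups in Three Variables*, Ann. of Math. Stud. 123 (1990), §4.9 Prop. 4.9.1 (a) p. 55, §4.10 p. 58.
* [LanglandsShelstad1987] R. P. Langlands, D. Shelstad, *On the definition of transfer factors*, Math. Ann. 278 (1987), §3.
-/

set_option autoImplicit false

noncomputable section

namespace Summit.HodgeConjecture.HodgeConjecture.Cruxes.H413.F0P3cDyRamKappaSignModelSumTokenOfKappaStageB

open scoped Valued WithZero Matrix MatrixGroups
open Literature.NumberTheory.Automorphic Literature.NumberTheory.Automorphic.HermitianLattice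
  Literature.NumberTheory.Automorphic.UnitaryLatticeTree Literature.NumberTheory.Automorphic.UnitaryThreeFourFrame
open Summit.HodgeConjecture.HodgeConjecture.Cruxes.H413.F0P3cDyRamFourFrameLawDefs
open Summit.HodgeConjecture.HodgeConjecture.Cruxes.H413.F0P3cDyRamFourFrameLawDefsR
open Summit.HodgeConjecture.HodgeConjecture.Cruxes.H413.F0P3cDyRamDiagonalTorusDefs
open Summit.HodgeConjecture.HodgeConjecture.Cruxes.H413.F0P3cDyRamDiagonalStrataDefs
open Summit.HodgeConjecture.HodgeConjecture.Cruxes.H413.F0P3cDyRamDiagonalKappaCountDefs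
open Summit.HodgeConjecture.HodgeConjecture.Cruxes.H413.F0P3cDyRamDiagonalKappaOrbitCount
open Summit.HodgeConjecture.HodgeConjecture.Cruxes.H413.F0P3cDyRamStableModelSumOfStageB

/-! ## §1 THE ENGINE — sign token `S` arbitrary -/

/-- **(KSS)-SHAPED REDUCTION MODULO COMPLETE-FIELD κ-STAGE B, FOR AN ARBITRARY SIGN TOKEN `S`.**  `S` is any integer-valued token of the telescope data
`(σ, ϖ, d, t, δ, a, b, i)` (polymorphic in the complete valued field `K` with finite residue field); `hAκ2` is the registered (κ-A₂) `stub_U3_kappaStageA_typeTwo_mult` VERBATIM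
(κ-Stage A at type 2 with multiplicity: `↑(Σ_e χ⁰_i(e)·#{M : type-2 for diag(d_e), T·M = M}) = 8·Σᶠ_{M ∈ 𝓛₀(T), IsTypeTwoPolarisable} kappaCount σ ϖ 2 i M · stabiliserWeight σ M`);
`hBκS` ∕ `hBκS₂` are the type-0 ∕ type-2 SIGNED κ-STAGE-B SUMS at the square element datum `(a², b²)` with right-hand sides `S·ampl q k B ∕ 4` ∕ `S·ampl q k (B + tauOfRecord d) ∕ 4`
(the ED. 10 (κS-B₀)∕(κS-B₂) telescopes VERBATIM but for the sign token).  Conclusion: behind the dyadic fence, the two eightfold signed model sums equal `2·S·ampl q k B` and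
`2·S·ampl q k (B + tauOfRecord d)`.  Inside: ★ p856175 §1 (non-norm `c`), §2 (regular unit diagonal), ★ (Oκ2c)₀ (type 0, unconditional), `hAκ2` (type 2), `8·(S·A∕4) = 2·S·A`.
Every Ω-re-lettered (KSS²) head is `kappaSignModelSum_of_kappaStageB_token (S := fun σ ϖ d t δ a b i => ‹token›)` applied to the three inputs.
[cite: Kottwitz1986BaseChangeUnits, §1 pp. 240–241] [cite: Rogawski1990, §4.9 Prop. 4.9.1 (a) p. 55] [cite: LanglandsShelstad1987, §3] -/
theorem kappaSignModelSum_of_kappaStageB_token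
    (S : ∀ {K : Type} [Field K] [Valued K ℤᵐ⁰] [CompleteSpace K] [Fintype 𝓀[K]], (K →+* K) → K → ℕ → ℕ → K → K → K → Fin 3 → ℤ)
    (hAκ2 : ∀ {K : Type} [Field K] [Valued K ℤᵐ⁰] [Finite 𝓀[K]] {σ : K →+* K}, (∀ x, σ (σ x) = x) → (∀ a, Valued.v (σ a) = Valued.v a) →
      ∀ {ϖ : K}, Valued.v ϖ = WithZero.exp (-1 : ℤ) → ∀ (ϖu : Kˣ), (ϖu : K) = ϖ →
      ∀ {c : K}, σ c = c → Valued.v c = 1 → (¬ ∃ z : K, z * σ z = c) →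
        (∀ x : K, σ x = x → x ≠ 0 → (∃ z : K, z * σ z = x) ∨ ∃ z : K, z * σ z = c * x) →
      ∀ {s : Fin 3 → K}, (∀ i, Valued.v (s i) = 1) → (∀ i j, i ≠ j → s i ≠ s j) →
      ∀ (T : GL (Fin 3) K), (T : Matrix (Fin 3) (Fin 3) K) = Matrix.diagonal s → ∀ (i : Fin 3),
        (((∑ e : Fin 3 → Bool,
            (![(if e 1 then -1 else 1) * (if e 2 then -1 else 1),
               (if e 0 then -1 else 1) * (if e 2 then -1 else 1),
               (if e 0 then -1 else 1) * (if e 1 then -1 else 1)] : Fin 3 → ℤ) i *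
              ({M : Submodule 𝒪[K] (Fin 3 → K) |
                IsVertexLattice σ ϖ (Matrix.diagonal fun j => if e j then c else (1 : K)) 2 M ∧ mapGL T M = M}.ncard : ℤ) : ℤ) : ℚ)) =
          8 * ∑ᶠ M₀ ∈ {M : Submodule 𝒪[K] (Fin 3 → K) | M ∈ normalisedStableLattices T ∧ IsTypeTwoPolarisable σ ϖ M},
            (kappaCount σ ϖ 2 i M₀ : ℚ) * stabiliserWeight σ M₀)
    (hBκS : ∀ {K : Type} [Field K] [Valued K ℤᵐ⁰] [CompleteSpace K] [Fintype 𝓀[K]] {σ : K →+* K} {ϖ : K} {d t : ℕ}, IsRamifiedQuadraticDatum σ ϖ d t →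
      Valued.v (2 : K) < 1 → ∀ {δ : K}, σ δ = -δ → δ ≠ 0 →
      ∀ {a b : K}, a * σ a = 1 → b * σ b = 1 → Valued.v (a - 1) < Valued.v (2 : K) → Valued.v (b - 1) < Valued.v (2 : K) →
      ∀ {n₁ n₂ n₃ : ℕ}, IsElementDatum σ ϖ (depthOfRecord d) (a * a) (b * b) n₁ n₂ n₃ →
      ∀ (T : GL (Fin 3) K), (T : Matrix (Fin 3) (Fin 3) K) = Matrix.diagonal ![a * a, b * b, 1] → ∀ (k : ℕ), 2 * k + d = n₁ + n₂ + n₃ + 2 →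
      ∀ (i : Fin 3) (B : ℤ), 2 * B = ((![n₁, n₂, n₃] : Fin 3 → ℕ) i : ℤ) - d + 2 - 2 * shiftR d t →
        ∑ᶠ M ∈ {M : Submodule 𝒪[K] (Fin 3 → K) | M ∈ normalisedStableLattices T ∧ IsDualisableLattice σ ϖ M},
            (kappaCount σ ϖ 0 i M : ℚ) * stabiliserWeight σ M =
          ((S σ ϖ d t δ a b i : ℤ) : ℚ) * ampl (Fintype.card 𝓀[K]) k B / 4)
    (hBκS₂ : ∀ {K : Type} [Field K] [Valued K ℤᵐ⁰] [CompleteSpace K] [Fintype 𝓀[K]] {σ : K →+* K} {ϖ : K} {d t : ℕ}, IsRamifiedQuadraticDatum σ ϖ d t →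
      Valued.v (2 : K) < 1 → ∀ {δ : K}, σ δ = -δ → δ ≠ 0 →
      ∀ {a b : K}, a * σ a = 1 → b * σ b = 1 → Valued.v (a - 1) < Valued.v (2 : K) → Valued.v (b - 1) < Valued.v (2 : K) →
      ∀ {n₁ n₂ n₃ : ℕ}, IsElementDatum σ ϖ (depthOfRecord d) (a * a) (b * b) n₁ n₂ n₃ →
      ∀ (T : GL (Fin 3) K), (T : Matrix (Fin 3) (Fin 3) K) = Matrix.diagonal ![a * a, b * b, 1] → ∀ (k : ℕ), 2 * k + d = n₁ + n₂ + n₃ + 2 →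
      ∀ (i : Fin 3) (B : ℤ), 2 * B = ((![n₁, n₂, n₃] : Fin 3 → ℕ) i : ℤ) - d + 2 - 2 * shiftR d t →
        ∑ᶠ M ∈ {M : Submodule 𝒪[K] (Fin 3 → K) | M ∈ normalisedStableLattices T ∧ IsTypeTwoPolarisable σ ϖ M},
            (kappaCount σ ϖ 2 i M : ℚ) * stabiliserWeight σ M =
          ((S σ ϖ d t δ a b i : ℤ) : ℚ) * ampl (Fintype.card 𝓀[K]) k (B + tauOfRecord d) / 4) :
    ∀ {K : Type} [Field K] [Valued K ℤᵐ⁰] [CompleteSpace K] [Fintype 𝓀[K]] (σ : K →+* K) (ϖ : K) (d t : ℕ),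
      DyadicFence (K := K) (IsRamifiedQuadraticDatum σ ϖ d t →
        ∀ c : K, σ c = c → Valued.v c = 1 → (∀ x : K, σ x = x → x ≠ 0 → (∃ z : K, z * σ z = x) ∨ ∃ z : K, z * σ z = c * x) →
        ∀ (δ : K), σ δ = -δ → δ ≠ 0 →
        ∀ (a b : K), a * σ a = 1 → b * σ b = 1 → Valued.v (a - 1) < Valued.v (2 : K) → Valued.v (b - 1) < Valued.v (2 : K) →
        ∀ (n₁ n₂ n₃ : ℕ), IsElementDatum σ ϖ (depthOfRecord d) (a * a) (b * b) n₁ n₂ n₃ →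
        ∀ (T : GL (Fin 3) K), (T : Matrix (Fin 3) (Fin 3) K) = Matrix.diagonal ![a * a, b * b, 1] →
        ∀ (k : ℕ), 2 * k + d = n₁ + n₂ + n₃ + 2 →
        ∀ (i : Fin 3) (B : ℤ), 2 * B = ((![n₁, n₂, n₃] : Fin 3 → ℕ) i : ℤ) - d + 2 - 2 * shiftR d t →
          ((∑ s : Fin 3 → Bool,
              (![(if s 1 then -1 else 1) * (if s 2 then -1 else 1),
                 (if s 0 then -1 else 1) * (if s 2 then -1 else 1),
                 (if s 0 then -1 else 1) * (if s 1 then -1 else 1)] : Fin 3 → ℤ) i *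
                ({M : Submodule 𝒪[K] (Fin 3 → K) |
                  IsVertexLattice σ ϖ (Matrix.diagonal fun j => if s j then c else (1 : K)) 0 M ∧ mapGL T M = M}.ncard : ℤ) : ℤ) : ℚ) =
            2 * ((S σ ϖ d t δ a b i : ℤ) : ℚ) * ampl (Fintype.card 𝓀[K]) k B ∧
          ((∑ s : Fin 3 → Bool,
              (![(if s 1 then -1 else 1) * (if s 2 then -1 else 1),
                 (if s 0 then -1 else 1) * (if s 2 then -1 else 1),
                 (if s 0 then -1 else 1) * (if s 1 then -1 else 1)] : Fin 3 → ℤ) i *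
                ({M : Submodule 𝒪[K] (Fin 3 → K) |
                  IsVertexLattice σ ϖ (Matrix.diagonal fun j => if s j then c else (1 : K)) 2 M ∧ mapGL T M = M}.ncard : ℤ) : ℤ) : ℚ) =
            2 * ((S σ ϖ d t δ a b i : ℤ) : ℚ) * ampl (Fintype.card 𝓀[K]) k (B + tauOfRecord d)) := by
  intro K _ _ _ _ σ ϖ d t h2 hD c hσc hcv hdich δ hδ hδ0 a b ha hb ha2 hb2 n₁ n₂ n₃ hE T hT k hk i B hB
  have hσ : ∀ x, σ (σ x) = x := hD.1
  have hvσ : ∀ a, Valued.v (σ a) = Valued.v a := hD.2.1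
  have hϖ : Valued.v ϖ = WithZero.exp (-1 : ℤ) := hD.2.2.1
  -- (1) `c` is a non-norm; (2) the eigenvalues `(a², b², 1)` form a regular unit diagonal (★ p856175 §1–§2)
  have hc : ¬ ∃ z : K, z * σ z = c := not_exists_mul_map_eq_of_dichotomy hD h2 hcv hdich
  have hs := v_vecCons_eq_one_of_isElementDatum hvσ hE
  have hreg := vecCons_injective_of_isElementDatum hE
  have hϖ0 : ϖ ≠ 0 := (Valuation.ne_zero_iff _).1 (by rw [hϖ]; exact WithZero.exp_ne_zero)
  -- (5) `8·(S·A∕4) = 2·S·A`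
  have h8 : ∀ (X S' A : ℚ), X = S' * A / 4 → 8 * X = 2 * S' * A := fun X S' A h => by rw [h]; ring
  constructor
  · -- (3) type 0: κ-Stage A₀ (★ (Oκ2c)₀, unconditional), then the token-`S` κ-Stage B₀
    rw [cast_sum_signChar_mul_ncard_eq_eight_mul_finsum_kappaCount_zero hσ hvσ hϖ (Units.mk0 ϖ hϖ0) rfl hσc hcv hc hdich hs hreg T hT i]
    exact h8 _ _ _ (hBκS hD h2 hδ hδ0 ha hb ha2 hb2 hE T hT k hk i B hB)
  · -- (4) type 2: κ-Stage A₂ with multiplicity, then the token-`S` κ-Stage B₂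
    rw [hAκ2 hσ hvσ hϖ (Units.mk0 ϖ hϖ0) rfl hσc hcv hc hdich hs hreg T hT i]
    exact h8 _ _ _ (hBκS₂ hD h2 hδ hδ0 ha hb ha2 hb2 hE T hT k hk i B hB)

end Summit.HodgeConjecture.HodgeConjecture.Cruxes.H413.F0P3cDyRamKappaSignModelSumTokenOfKappaStageB

end
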